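import Literature.MathematicalPhysics.QuantumLattice.GrassmannGaussianAddition
import Literature.MathematicalPhysics.QuantumLattice.GrassmannGaussianMeasureChange
import HarnessLib

/-!
# Gauge-covariant block averaging for lattice (Wilson) fermions
(trunk QLatticeAQFT; definition request `WilsonFermionBlockAveraging` of route
`QuantumFields/QCD/HeavyThresholdYMBridge`, needed to type its crux `FermionicUVFlow` and the
coercivity clause of `HeavyBlockIntegration`)

## Content

1. **Matrix data of one fermionic block RG step** (any commutative ring `R`, fine index `m`, coarse
   index `n`; Bałaban–O'Carroll–Schor 1989, §II): for a Gaussian parameter `a`, an averaging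
   operator `Q` (coarse × fine), a conjugate averaging operator `Q̄` (fine × coarse) and a fine
   action `ψ̄Dψ`:
   `fluctuationOp a Q Q̄ D = D + aQ̄Q` and its inverse `fluctuationPropagator` (the fluctuation
   two-point function `Γ` of loc. cit. (2.3)); the **block Dirac operator**
   `blockDirac a Q Q̄ D = a·1 - a² Q (D + aQ̄Q)⁻¹ Q̄` (Lemma II.2–II.3), its inverse
   `blockPropagator` and the effective determinant `blockDetFactor = det (D + aQ̄Q)`.
   Proved: `blockDirac_mul_avgPropagator` (`D₁ (a⁻¹ + QD⁻¹Q̄) = 1`, the Woodbury identity behind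
   Lemma II.4 (b)), the conjugation (gauge) covariance `fluctuationOp_conj`, `blockDirac_conj`, and
   compatibility with relabelling `fluctuationOp_reindex`, `blockDirac_reindex`.
2. **The block RG transformation as a Grassmann integral** (loc. cit. (1.1); Dimock 2022, §2):
   in the joint Grassmann algebra on `BlockRGIdx n m = (n ⊕ₗ n) ⊕ₗ (m ⊕ₗ m)` (block fermions
   `χ̄, χ` = `chiBar`, `chi` before the fine ones `ψ̄, ψ` = `psiBarF`, `psiF`), the exponent
   `blockRGExponent a Q Q̄ = -a Σ_y (χ̄_y - (ψ̄Q̄)_y)(χ_y - (Qψ)_y)`, the weight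
   `blockRGWeight = exp (blockRGExponent)` and the `R`-linear map
   `fermionBlockRG a Q Q̄ : Λ(ψ̄, ψ) →ₗ Λ(χ̄, χ)`, `ρ ↦ ∫ dψ̄dψ e^{-a(χ̄-ψ̄Q̄)(χ-Qψ)} ρ` (embed, multiply
   by the weight, `berezinOn` the fine variables, restrict).  **Main theorem**
   `fermionBlockRG_grassmannExp_quadratic`: if `det (D + aQ̄Q)` is a unit,
   `fermionBlockRG a Q Q̄ (exp (-ψ̄Dψ)) = ε det (-(D + aQ̄Q)) • exp (-χ̄ D₁ χ)`, `D₁ = blockDirac a Q Q̄ D`,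
   `ε = (-1)^{|m|(|m|-1)/2}` — the exact fermionic Gaussian integration of BOS Lemma II.2, proved
   from the tree's Gaussian Berezin integral with sources (`GrassmannGaussianSources`).
3. **Gauge-covariant averaging on the torus** (Bałaban 1984, §1; Dimock 2022, §2): lattice paths
   `pathEdges`, `pathEnd`, parallel transporters `transport U c dirs` with
   `transport_gaugeTransform` (`U^g(Γ) = g(c) U(Γ) g(x)⁻¹`); blocks of side `M` of the fine torus
   `(ℤ/ML'ℤ)^d` over the coarse torus `(ℤ/L'ℤ)^d`: `torusBlockOf`, `torusBlockCorner`,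
   `torusBlockOffset`, the fixed coordinate-ordered path `torusBlockPath` and the block transporter
   `blockTransporter M L' U x` with `blockTransporter_gaugeTransform`; the fermionic gauge rotation
   matrices `gaugeRotation ρ σ g` (`𝒢(g)𝒢(h) = 𝒢(gh)`), and the **covariant block averaging
   operators** `fermionBlockAvg M L' ρ σ U = Q(U)`, `(Q(U)ψ)(y) = M^{-d} Σ_{x∈B(y)} ρ(U(Γ_{y,x})) ψ(x)`,
   `fermionBlockAvgBar = Q̄(U)` (inverse transporters), with the covariance theorems
   `fermionBlockAvg_gaugeTransform : Q(U^g) = 𝒢'(g ∘ corner) Q(U) 𝒢(g)⁻¹` and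
   `fermionBlockAvgBar_gaugeTransform`; the hopping decomposition `wilsonDirac_eq` of the tree's
   Wilson–Dirac operator and its gauge covariance `wilsonDirac_gaugeTransform`.
4. **Wilson fermions** (`d = 4`, spin `Fin 4`, the tree's `wilsonDirac ρ U m r`): the structure
   `WilsonFermionBlockAveraging` (block side `M ≥ 2`, Gaussian parameter `a > 0`) with, in its
   namespace, `avg`, `avgBar`, `fluctuationOp`, `blockDirac`, `blockPropagator`, `detFactor`, the
   lattice-QCD specialisation `qcdBlockDirac` (`SU(3)`, `fundamentalRep (Fin 3)`, `r = 1`), the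
   enumeration `WilsonIdx`/`wilsonIdxEquiv`, the block RG transformation `transform` on Grassmann
   densities and the exact step `transform_grassmannExp_wilsonDirac`, plus `avg_gaugeTransform`,
   `avgBar_gaugeTransform`, `fluctuationOp_gaugeTransform`, `blockDirac_gaugeTransform`
   (`D₁(U^g) = 𝒢'(g∘corner) D₁(U) 𝒢'(g∘corner)⁻¹`) and `detFactor_gaugeTransform` (`det F(U^g) = det F(U)`).

## Sources

* T. Bałaban, M. O'Carroll, R. Schor, *Block renormalization group for Euclidean fermions*,
  Commun. Math. Phys. 122 (1989) 233–247 (held: `paper:doi-10-1007-bf01257414`): §I (1.1) p. 234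
  (the RGT `(T_{a,L}ρ)(χ̄,χ) = N ∫ exp[-a(Lε)⁻¹(χ̄ - φ̄Q⁺, χ - Qφ)] ρ(φ̄,φ) dφ̄dφ`), (1.2) (normalisation),
  (1.3) (composition law), §II p. 237: "`∫ dφ̄dφ e^{(φ̄,Aφ)} = det A`, the translation formula, and
  `∫ dφ̄dφ exp[(φ̄,Aφ) + (J̄,φ) + (φ̄,J)] = det A e^{-(J̄,A⁻¹J)}`", Lemma II.1 (composition), Lemma II.2
  (`D^{(k)} = a_k - a_k² Q_k G_k Q_k⋆`), (2.3) (`Γ^{(k)} = (D^{(k)} + a(L^{k+1}ε)⁻¹Q⋆Q)⁻¹`), Lemma II.3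
  (one-step recursion), Lemma II.4 (b) (the inverse form), Theorem II.1; bib `BalabanOcarrollSchor1989`.
* J. Dimock, *Stability for QED in d = 3: an overview*, J. Math. Phys. 63 (2022) 042305,
  arXiv:2204.07201 (held: `paper:arxiv-2204.07201`), §2 p. 4: "For fermion fields `Ψ₀` the averaging
  operator in the presence of the gauge field `A₀` is `(Q(A₀)Ψ₀)(y) = L⁻³ Σ_{x∈B(y)} e^{ie₀A₀(Γ(y,x))} Ψ₀(x)`
  … We use it to parallel translate to the center of the cube before averaging, so that gauge
  covariance is preserved", and the Gaussian RG step
  `ρ̃₁(A₁,Ψ₁) = N₀ ∫ … exp(-(b/L)⟨Ψ̄₁ - Q(-A₀)Ψ̄₀, Ψ₁ - Q(A₀)Ψ₀⟩) ρ₀(A₀,Ψ₀)` ("We have avoided using a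
  delta function for the fermion fields (which would not work for Grassmann elements) and instead
  used a Gaussian factor"); bib `Dimock2022QED3`.
* T. Bałaban, *Propagators and renormalization transformations for lattice gauge theories. I*,
  Commun. Math. Phys. 95 (1984) 17–40, §1 (1.4)–(1.7) (block averages of gauge fields, straight-line
  transporters, gauge covariance); bib `Balaban1984Propagators` (as in `BalabanRG.lean`).
* M. Salmhofer, *Renormalization* (1999), App. B Lemma B.6 (Gaussian Grassmann integral with
  sources), through `GrassmannGaussianSources.lean`; I. Montvay, G. Münster, *Quantum Fields on a
  Lattice* (1994), §4.2, §5.1 (Wilson fermions), through `GrassmannIntegral.lean`.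

## Design choices and conventions

* Blocks are labelled by corners `M y` rather than centres (as in `BalabanRG.blockBase`); the fixed
  path `Γ_{y,x}` runs from the corner to `x`, first `x₀ mod M` steps in direction `0`, then direction
  `1`, …, along positively oriented edges only, so transporters need no inverses.  The fine torus has
  side `M * L'` over the coarse torus of side `L'` (so `NeZero` propagates and no divisibility
  hypothesis is needed); one step is `TorusSite d (M * L') → TorusSite d L'`, and iteration is
  re-instantiation.
* `Q` and `Q̄` are plain matrices with the arithmetic-mean weight `M^{-d}`; the Riemann-sum weights
  of BOS's inner products and Dimock's `b/L` are absorbed into the free parameter `a`.  `Q̄(U)` uses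
  the inverse transporter `ρ(U(Γ)⁻¹)` (for unitary `ρ` this is `Q(U)†`), so no unitarity is assumed.
* Sign conventions are the tree's: `quadratic R A = Σ Aᵢⱼ ψ̄ᵢψⱼ`, densities `exp (quadratic R (-D))`,
  orientation `∫ ψ̄₁⋯ψ̄ₙψ₁⋯ψₙ = 1` producing `ε = (-1)^{n(n-1)/2}`; hence the constant
  `ε det (-(D + aQ̄Q))` in the main theorem.  The normalisation `N` of BOS (1.2) is not included in
  `fermionBlockRG`.
* Gauge covariance of the tree's `wilsonDirac` is proved here (`wilsonDirac_gaugeTransform`, via the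
  hopping matrices `wilsonHopFwd`/`wilsonHopBwd`), whence `blockDirac_gaugeTransform` and the gauge
  invariance of the effective determinant `detFactor_gaugeTransform`.
* Not formalised here: the composition law (1.3)/Lemma II.1, the exponential decay of the kernels
  (§III), and the block averaging of the gauge field itself (see `BalabanRG.axialBlockHolonomy` on
  `ℤ^d`).

## Mathlib status

Mathlib has matrices, `Matrix.reindex`, the Woodbury identity (`Matrix.add_mul_mul_inv_eq_sub`),
`ExteriorAlgebra`, `IsNilpotent.exp`; it has no Berezin integral, block-spin/renormalisation-group
transformation, lattice gauge field or lattice Dirac operator (grep `renormali`, `block spin`,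
`Berezin`, `Dirac operator`).  Everything fermionic rests on the tree's `GrassmannIntegral*.lean`,
`GrassmannGaussianSources.lean`, `GrassmannGaussianAddition.lean` (`inlLex`, `inrLex`, transport
lemmas).
-/

noncomputable section

open Finset Matrix

namespace Literature.MathematicalPhysics.QuantumLattice

section QLatticeAQFT


/-! ### One fermionic block RG step: matrix data -/

section BlockAlgebra

variable {R : Type*} [CommRing R] {m n : Type*} [Fintype m] [Fintype n] [DecidableEq m]
  [DecidableEq n]

/-- The **fluctuation operator** of one fermionic block RG step with Gaussian parameter `a`,
averaging operator `Q` (coarse × fine), conjugate averaging operator `Q̄` (fine × coarse) and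
fine action `ψ̄ D ψ`: the matrix `D + a Q̄ Q` of the quadratic form in the integrated (fine)
fermions after expanding the Gaussian weight `exp (-a (χ̄ - ψ̄Q̄)(χ - Qψ))`; its inverse is the
fluctuation-field two-point function `Γ = (D + a Q⋆Q)⁻¹` (Bałaban–O'Carroll–Schor 1989, §II,
(2.3)). [cite: BalabanOcarrollSchor1989, §II (2.3)] -/
def fluctuationOp (a : R) (Q : Matrix n m R) (Qb : Matrix m n R) (D : Matrix m m R) :
    Matrix m m R :=
  D + a • (Qb * Q)

/-- The **fluctuation propagator** `Γ = (D + a Q̄ Q)⁻¹` (nonsingular inverse; junk unless the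
determinant is a unit) (Bałaban–O'Carroll–Schor 1989, §II, (2.3)). [cite: BalabanOcarrollSchor1989, §II (2.3)] -/
def fluctuationPropagator (a : R) (Q : Matrix n m R) (Qb : Matrix m n R) (D : Matrix m m R) :
    Matrix m m R :=
  (fluctuationOp a Q Qb D)⁻¹

/-- The **block (effective) Dirac operator** after one fermionic block RG step:
`D₁ = a·1 - a² Q (D + a Q̄ Q)⁻¹ Q̄`, the matrix of the coarse action `χ̄ D₁ χ` obtained by
completing the square in `ψ̄Dψ + a(χ̄ - ψ̄Q̄)(χ - Qψ)` (Bałaban–O'Carroll–Schor 1989, §II,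
Lemma II.2: `D^{(k)} = a_k - a_k² Q_k G_k Q_k⋆`, and Lemma II.3 for one step). [cite: BalabanOcarrollSchor1989, §II Lemma II.2–II.3] -/
def blockDirac (a : R) (Q : Matrix n m R) (Qb : Matrix m n R) (D : Matrix m m R) :
    Matrix n n R :=
  a • (1 : Matrix n n R) - (a ^ 2) • (Q * (fluctuationOp a Q Qb D)⁻¹ * Qb)

/-- The **block propagator** `D₁⁻¹` (nonsingular inverse of `blockDirac`); when `a` and `D` are
invertible it equals `a⁻¹·1 + Q D⁻¹ Q̄`, the averaged fine propagator plus the white noise of the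
Gaussian smearing (`blockDirac_mul_avgPropagator`) (Bałaban–O'Carroll–Schor 1989, §II,
Lemma II.4 (b)). [cite: BalabanOcarrollSchor1989, §II Lemma II.4] -/
def blockPropagator (a : R) (Q : Matrix n m R) (Qb : Matrix m n R) (D : Matrix m m R) :
    Matrix n n R :=
  (blockDirac a Q Qb D)⁻¹

/-- The **effective determinant factor** `det (D + a Q̄ Q)` produced by the Gaussian Berezin
integral over the fine fermions in one block RG step (Bałaban–O'Carroll–Schor 1989, §II:
`∫ dφ̄ dφ e^{(φ̄,Aφ)} = det A`). [cite: BalabanOcarrollSchor1989, §II] -/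
def blockDetFactor (a : R) (Q : Matrix n m R) (Qb : Matrix m n R) (D : Matrix m m R) : R :=
  (fluctuationOp a Q Qb D).det

omit [Fintype m] [DecidableEq m] [DecidableEq n] in
/-- Unfolding `fluctuationOp`. [folklore] -/
theorem fluctuationOp_def (a : R) (Q : Matrix n m R) (Qb : Matrix m n R) (D : Matrix m m R) :
    fluctuationOp a Q Qb D = D + a • (Qb * Q) := rfl

/-- Unfolding `blockDirac`. [folklore] -/
theorem blockDirac_def (a : R) (Q : Matrix n m R) (Qb : Matrix m n R) (D : Matrix m m R) :
    blockDirac a Q Qb D =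
      a • (1 : Matrix n n R) - (a ^ 2) • (Q * (fluctuationOp a Q Qb D)⁻¹ * Qb) := rfl

/-- With `a = 0` (no coupling to the block field) the block action vanishes. [folklore] -/
@[simp] theorem blockDirac_zero (Q : Matrix n m R) (Qb : Matrix m n R) (D : Matrix m m R) :
    blockDirac 0 Q Qb D = 0 := by
  simp [blockDirac]

/-- **The block Dirac operator inverts the averaged propagator**: if `a` and `D` are invertible
(and the fluctuation operator is, so that its nonsingular inverse is a genuine inverse), then
`D₁ (a⁻¹·1 + Q D⁻¹ Q̄) = 1`, i.e. `D₁ = (a⁻¹ + Q D⁻¹ Q̄)⁻¹` — the Woodbury identity behind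
Bałaban–O'Carroll–Schor 1989, Lemma II.4 (b) (whose `a → ∞` limit is the "δ-function" block
operator `(Q D⁻¹ Q⋆)⁻¹`). [cite: BalabanOcarrollSchor1989, §II Lemma II.4] -/
theorem blockDirac_mul_avgPropagator {a : R} (ha : IsUnit a) (Q : Matrix n m R) (Qb : Matrix m n R)
    {D : Matrix m m R} (hD : IsUnit D.det) (hF : IsUnit (fluctuationOp a Q Qb D).det) :
    blockDirac a Q Qb D * ((Ring.inverse a) • (1 : Matrix n n R) + Q * D⁻¹ * Qb) = 1 := by
  obtain ⟨u, rfl⟩ := ha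
  rw [Ring.inverse_unit, blockDirac]
  set F := fluctuationOp (u : R) Q Qb D with hFdef
  have hDD' : D * D⁻¹ = 1 := D.mul_nonsing_inv hD
  -- the key identity `Q F⁻¹ Q̄ · Q D⁻¹ Q̄ = u⁻¹ (Q D⁻¹ Q̄ - Q F⁻¹ Q̄)`, from `Q̄ Q = u⁻¹ (F - D)`
  have key : Q * F⁻¹ * Qb * (Q * D⁻¹ * Qb) =
      ((u⁻¹ : Rˣ) : R) • (Q * D⁻¹ * Qb) - ((u⁻¹ : Rˣ) : R) • (Q * F⁻¹ * Qb) := by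
    have h1 : Qb * Q = ((u⁻¹ : Rˣ) : R) • (F - D) := by
      rw [hFdef, fluctuationOp, add_sub_cancel_left, smul_smul, Units.inv_mul, one_smul]
    calc Q * F⁻¹ * Qb * (Q * D⁻¹ * Qb)
        = Q * F⁻¹ * (Qb * Q) * D⁻¹ * Qb := by simp only [Matrix.mul_assoc]
      _ = ((u⁻¹ : Rˣ) : R) • (Q * F⁻¹ * (F - D) * D⁻¹ * Qb) := by
          rw [h1, Matrix.mul_smul, Matrix.smul_mul, Matrix.smul_mul]
      _ = ((u⁻¹ : Rˣ) : R) • (Q * D⁻¹ * Qb - Q * F⁻¹ * Qb) := by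
          congr 1
          have e1 : Q * F⁻¹ * (F - D) * D⁻¹ = Q * (F⁻¹ * F) * D⁻¹ - Q * F⁻¹ * (D * D⁻¹) := by
            simp only [Matrix.mul_sub, Matrix.sub_mul, Matrix.mul_assoc]
          rw [e1, F.nonsing_inv_mul hF, hDD', Matrix.mul_one, Matrix.mul_one, Matrix.sub_mul]
      _ = _ := by rw [smul_sub]
  have h1 : ((u⁻¹ : Rˣ) : R) * ((u : Rˣ) : R) = 1 := Units.inv_mul u
  have h2 : ((u⁻¹ : Rˣ) : R) * ((u : Rˣ) : R) ^ 2 = u := by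
    rw [pow_two, ← mul_assoc, Units.inv_mul, one_mul]
  have h3 : ((u : Rˣ) : R) ^ 2 * ((u⁻¹ : Rˣ) : R) = u := by
    rw [pow_two, mul_assoc, Units.mul_inv, mul_one]
  simp only [Matrix.sub_mul, Matrix.mul_add, Matrix.smul_mul, Matrix.mul_smul, Matrix.one_mul,
    Matrix.mul_one, smul_smul, key, smul_sub, h1, h2, h3, one_smul]
  abel

omit [DecidableEq m] in
/-- **Gauge covariance of the fluctuation operator** (abstract form): if the averaging operators
transform as `Q ↦ g' Q g⁻¹`, `Q̄ ↦ g Q̄ g'⁻¹` and the fine operator as `D ↦ g D g⁻¹` under a pair of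
invertible (fine / coarse gauge rotation) matrices, then `D + aQ̄Q ↦ g (D + aQ̄Q) g⁻¹`
(Bałaban–O'Carroll–Schor 1989 treat the free field; the covariant version is Dimock 2022, §2,
"gauge covariance is preserved"). [cite: Dimock2022QED3, §2] -/
theorem fluctuationOp_conj (a : R) (g gi : Matrix m m R) {g' g'i : Matrix n n R}
    (hg' : g'i * g' = 1) (Q : Matrix n m R) (Qb : Matrix m n R) (D : Matrix m m R) :
    fluctuationOp a (g' * Q * gi) (g * Qb * g'i) (g * D * gi) =
      g * fluctuationOp a Q Qb D * gi := by
  have e1 : g * Qb * g'i * (g' * Q * gi) = g * (Qb * Q) * gi := by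
    calc g * Qb * g'i * (g' * Q * gi) = g * Qb * (g'i * g') * Q * gi := by
          simp only [Matrix.mul_assoc]
      _ = g * (Qb * Q) * gi := by rw [hg', Matrix.mul_one, Matrix.mul_assoc g]
  rw [fluctuationOp, fluctuationOp, e1, Matrix.mul_add, Matrix.add_mul, Matrix.mul_smul,
    Matrix.smul_mul]

/-- **Gauge covariance of the block Dirac operator** (abstract form): under `Q ↦ g' Q g⁻¹`,
`Q̄ ↦ g Q̄ g'⁻¹`, `D ↦ g D g⁻¹` the block operator transforms with the COARSE rotation only,
`D₁ ↦ g' D₁ g'⁻¹` (Dimock 2022, §2: the covariant averaging makes the RG step commute with gauge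
transformations; free case Bałaban–O'Carroll–Schor 1989, §II). [cite: Dimock2022QED3, §2] -/
theorem blockDirac_conj (a : R) {g gi : Matrix m m R} (hg : gi * g = 1) {g' g'i : Matrix n n R}
    (hg' : g'i * g' = 1) (Q : Matrix n m R) (Qb : Matrix m n R) (D : Matrix m m R) :
    blockDirac a (g' * Q * gi) (g * Qb * g'i) (g * D * gi) = g' * blockDirac a Q Qb D * g'i := by
  have hg1 : g * gi = 1 := mul_eq_one_comm.1 hg
  have hg'1 : g' * g'i = 1 := mul_eq_one_comm.1 hg'
  have hinv : (g * fluctuationOp a Q Qb D * gi)⁻¹ = g * (fluctuationOp a Q Qb D)⁻¹ * gi := by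
    rw [Matrix.mul_inv_rev, Matrix.mul_inv_rev, Matrix.inv_eq_left_inv hg1,
      Matrix.inv_eq_left_inv hg, Matrix.mul_assoc]
  rw [blockDirac, blockDirac, fluctuationOp_conj a g gi hg', hinv]
  have e2 : g' * Q * gi * (g * (fluctuationOp a Q Qb D)⁻¹ * gi) * (g * Qb * g'i) =
      g' * (Q * (fluctuationOp a Q Qb D)⁻¹ * Qb) * g'i := by
    calc g' * Q * gi * (g * (fluctuationOp a Q Qb D)⁻¹ * gi) * (g * Qb * g'i)
        = g' * Q * (gi * g) * (fluctuationOp a Q Qb D)⁻¹ * (gi * g) * Qb * g'i := by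
          simp only [Matrix.mul_assoc]
      _ = g' * (Q * (fluctuationOp a Q Qb D)⁻¹ * Qb) * g'i := by
          simp only [hg, Matrix.mul_one, Matrix.mul_assoc]
  rw [e2, Matrix.mul_sub, Matrix.sub_mul, Matrix.mul_smul, Matrix.smul_mul, Matrix.mul_one, hg'1,
    Matrix.mul_smul, Matrix.smul_mul]

omit [Fintype m] [DecidableEq m] [DecidableEq n] in
/-- Relabelling the fermion indices commutes with forming the fluctuation operator. [folklore] -/
theorem fluctuationOp_reindex {m' n' : Type*} [Fintype m'] [Fintype n'] [DecidableEq m']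
    [DecidableEq n'] (a : R) (em : m ≃ m') (en : n ≃ n') (Q : Matrix n m R) (Qb : Matrix m n R)
    (D : Matrix m m R) :
    fluctuationOp a (reindex en em Q) (reindex em en Qb) (reindex em em D) =
      reindex em em (fluctuationOp a Q Qb D) := by
  simp only [fluctuationOp, reindex_apply, submatrix_mul_equiv, submatrix_add, submatrix_smul,
    Pi.add_apply]
  rfl

/-- Relabelling the fermion indices commutes with forming the block Dirac operator. [folklore] -/
theorem blockDirac_reindex {m' n' : Type*} [Fintype m'] [Fintype n'] [DecidableEq m']
    [DecidableEq n'] (a : R) (em : m ≃ m') (en : n ≃ n') (Q : Matrix n m R) (Qb : Matrix m n R)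
    (D : Matrix m m R) :
    blockDirac a (reindex en em Q) (reindex em en Qb) (reindex em em D) =
      reindex en en (blockDirac a Q Qb D) := by
  rw [blockDirac, blockDirac, fluctuationOp_reindex, inv_reindex]
  have hmul : reindex en em Q * reindex em em (fluctuationOp a Q Qb D)⁻¹ * reindex em en Qb =
      reindex en en (Q * (fluctuationOp a Q Qb D)⁻¹ * Qb) := by
    simp only [reindex_apply, submatrix_mul_equiv]
  rw [hmul]
  simp only [reindex_apply, submatrix_sub, Pi.sub_apply, submatrix_smul, Pi.smul_apply,
    submatrix_one_equiv]

end BlockAlgebra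



/-! ### Paths, parallel transporters and blocks on the discrete torus -/

section TorusPaths

open Literature.Probability.LatticeModels QuantumFieldTheory

variable {d L : ℕ} {G : Type*}

/-- The lattice path starting at the site `c` and stepping successively in the (positive)
directions listed in `is`: its list of (positively oriented) edges
`(c, i₁), (c + e_{i₁}, i₂), …` (Bałaban CMP 95 (1984) §1, the contours `Γ_{y,x}`; Dimock 2022 §2,
the paths `Γ(y, x)`). [cite: Balaban1984Propagators, §1 (1.5)] -/
def pathEdges : QuantumFieldTheory.Site d L → List (Fin d) → List (QuantumFieldTheory.Edge d L)
  | _, [] => []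
  | c, i :: is => (c, i) :: pathEdges (c.shift i) is

/-- The endpoint `c + e_{i₁} + ⋯ + e_{iₖ}` of the path from `c` with steps `is`. [folklore] -/
def pathEnd (c : QuantumFieldTheory.Site d L) (is : List (Fin d)) : QuantumFieldTheory.Site d L :=
  is.foldl QuantumFieldTheory.Site.shift c

/-- The **parallel transporter** `U(Γ) = U(c, i₁) U(c + e_{i₁}, i₂) ⋯` of the gauge field `U`
along the path from `c` with steps `is` (ordered product of the link variables; only positively
oriented edges occur, so no inverses are needed) (Bałaban CMP 95 (1984) (1.5); Dimock 2022 §2,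
`e^{ie A(Γ)}` in the abelian case). [cite: Balaban1984Propagators, §1 (1.5)] -/
def transport [Monoid G] (U : GaugeConfig d L G) (c : QuantumFieldTheory.Site d L)
    (is : List (Fin d)) : G :=
  ((pathEdges c is).map U).prod

/-- The empty path ends where it starts. [folklore] -/
@[simp] theorem pathEnd_nil (c : QuantumFieldTheory.Site d L) : pathEnd c [] = c := rfl

/-- The endpoint after a first step `i` is the endpoint of the remaining path from `c + eᵢ`. [folklore] -/
@[simp] theorem pathEnd_cons (c : QuantumFieldTheory.Site d L) (i : Fin d) (is : List (Fin d)) :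
    pathEnd c (i :: is) = pathEnd (c.shift i) is := rfl

/-- The transporter along the empty path is `1`. [folklore] -/
@[simp] theorem transport_nil [Monoid G] (U : GaugeConfig d L G) (c : QuantumFieldTheory.Site d L) :
    transport U c [] = 1 := rfl

/-- The transporter splits off its first link variable: `U(Γ) = U(c, i) U(Γ')`
(Bałaban CMP 95 (1984) (1.5)). [folklore] -/
@[simp] theorem transport_cons [Monoid G] (U : GaugeConfig d L G) (c : QuantumFieldTheory.Site d L)
    (i : Fin d) (is : List (Fin d)) :
    transport U c (i :: is) = U (c, i) * transport U (c.shift i) is := by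
  simp [transport, pathEdges]

/-- The endpoint of a path is its start translated by the sum of the unit steps. [folklore] -/
theorem pathEnd_eq_add (c : QuantumFieldTheory.Site d L) (is : List (Fin d)) :
    pathEnd c is = c + (is.map fun i => (Pi.single i (1 : ZMod L) : QuantumFieldTheory.Site d L)).sum := by
  induction is generalizing c with
  | nil => simp
  | cons i is ih =>
    rw [pathEnd_cons, ih, List.map_cons, List.sum_cons, QuantumFieldTheory.Site.shift, add_assoc]

/-- **Gauge covariance of parallel transport**: under `U(x,i) ↦ g(x) U(x,i) g(x+eᵢ)⁻¹` the
transporter along a path from `c` to `x` transforms as `U(Γ) ↦ g(c) U(Γ) g(x)⁻¹` (telescoping of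
the ordered product) (Bałaban CMP 95 (1984) (1.7); Dimock 2022 §2). [cite: Balaban1984Propagators, §1 (1.7)] -/
theorem transport_gaugeTransform [Group G] (g : QuantumFieldTheory.Site d L → G) (U : GaugeConfig d L G)
    (c : QuantumFieldTheory.Site d L) (is : List (Fin d)) :
    transport (gaugeTransform g U) c is = g c * transport U c is * (g (pathEnd c is))⁻¹ := by
  induction is generalizing c with
  | nil => simp
  | cons i is ih =>
    rw [transport_cons, transport_cons, ih, pathEnd_cons]
    simp only [gaugeTransform]
    group

end TorusPaths

section TorusBlocks

open Literature.Probability.LatticeModels QuantumFieldTheory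

variable {d : ℕ} (M L' : ℕ) {G : Type*}

/-- The block (coarse site) of a site `x` of the fine torus `(ℤ/ML'ℤ)^d` under blocking with
block side `M`: `⌊x / M⌋` coordinatewise on representatives in `[0, ML')`, a site of the coarse
torus `(ℤ/L'ℤ)^d` (Bałaban–O'Carroll–Schor 1989, §I: blocks of side `L` of the `ε`-lattice;
Dimock 2022, §2, the cubes `B(y)`). [cite: BalabanOcarrollSchor1989, §I] -/
def torusBlockOf (x : TorusSite d (M * L')) : TorusSite d L' :=
  fun i => (((x i).val / M : ℕ) : ZMod L')

/-- The base corner `M y` (in the fine torus) of the block labelled by the coarse site `y`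
(Bałaban and Dimock use block centres; corners give the same combinatorics up to a translation,
as in `BalabanRG.blockBase`). [folklore] -/
def torusBlockCorner (y : TorusSite d L') : TorusSite d (M * L') :=
  fun i => ((M * (y i).val : ℕ) : ZMod (M * L'))

/-- The offset `x mod M ∈ {0, …, M-1}^d` of a fine site from the corner of its block. [folklore] -/
def torusBlockOffset (x : TorusSite d (M * L')) : Fin d → ℕ :=
  fun i => (x i).val % M

/-- The fixed path from the corner of the block of `x` to `x`: `x₀ mod M` steps in direction `0`,
then `x₁ mod M` steps in direction `1`, and so on (the coordinate-ordered taxi path; Bałaban CMP 95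
(1984) §1, Dimock 2022 §2 "`Γ(y,x)` is a path from `x` to `y`", here traversed from the block
representative to `x`). [folklore] -/
def torusBlockPath (x : TorusSite d (M * L')) : List (Fin d) :=
  ((List.finRange d).map fun i => List.replicate (torusBlockOffset M L' x i) i).flatten

/-- The **block parallel transporter** `U(Γ_{y,x})` from the corner of the block `y ∋ x` to the
fine site `x` along the fixed path `torusBlockPath` (Bałaban CMP 95 (1984) (1.5); Dimock 2022
§2). [cite: Dimock2022QED3, §2] -/
def blockTransporter [Monoid G] (U : GaugeConfig d (M * L') G) (x : TorusSite d (M * L')) : G :=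
  transport U (torusBlockCorner M L' (torusBlockOf M L' x)) (torusBlockPath M L' x)

variable {M L'}

/-- The corner of the block `y` lies in the block `y`. [folklore] -/
theorem torusBlockOf_torusBlockCorner [NeZero M] [NeZero L'] (y : TorusSite d L') :
    torusBlockOf M L' (torusBlockCorner M L' y) = y := by
  funext i
  have hM : 0 < M := Nat.pos_of_ne_zero (NeZero.ne M)
  have hlt : M * (y i).val < M * L' := Nat.mul_lt_mul_of_pos_left (ZMod.val_lt (y i)) hM
  simp only [torusBlockOf, torusBlockCorner, ZMod.val_natCast_of_lt hlt, Nat.mul_div_cancel_left _ hM,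
    ZMod.natCast_zmod_val]

/-- The coordinates of the block of `x` are `⌊xᵢ / M⌋ < L'`. [folklore] -/
theorem val_torusBlockOf [NeZero M] [NeZero L'] (x : TorusSite d (M * L')) (i : Fin d) :
    (torusBlockOf M L' x i).val = (x i).val / M := by
  have hM : 0 < M := Nat.pos_of_ne_zero (NeZero.ne M)
  have h : (x i).val / M < L' := Nat.div_lt_of_lt_mul (ZMod.val_lt (x i))
  simp only [torusBlockOf, ZMod.val_natCast_of_lt h]

/-- `x = M ⌊x/M⌋ + (x mod M)`: a fine site is the corner of its block plus its offset. [folklore] -/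
theorem torusBlockCorner_torusBlockOf_add_offset [NeZero M] [NeZero L'] (x : TorusSite d (M * L')) :
    torusBlockCorner M L' (torusBlockOf M L' x) + (fun i => ((torusBlockOffset M L' x i : ℕ) : ZMod (M * L'))) = x := by
  funext i
  simp only [Pi.add_apply, torusBlockCorner, val_torusBlockOf, torusBlockOffset]
  rw [← Nat.cast_add, Nat.div_add_mod, ZMod.natCast_zmod_val]

/-- The fixed block path of `x` ends at `x`. [folklore] -/
theorem pathEnd_torusBlockPath [NeZero M] [NeZero L'] (x : TorusSite d (M * L')) :
    pathEnd (torusBlockCorner M L' (torusBlockOf M L' x)) (torusBlockPath M L' x) = x := by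
  rw [pathEnd_eq_add]
  conv_rhs => rw [← torusBlockCorner_torusBlockOf_add_offset x]
  congr 1
  rw [torusBlockPath, List.map_flatten, List.sum_flatten, List.map_map, List.map_map,
    ← Fin.sum_univ_def]
  funext j
  simp only [Function.comp_def, List.map_replicate, List.sum_replicate, Finset.sum_apply,
    Pi.smul_apply, Pi.single_apply, smul_ite, smul_zero, Nat.smul_one_eq_cast]
  rw [Finset.sum_ite_eq, if_pos (Finset.mem_univ j)]

/-- **Gauge covariance of the block transporter**: `U^g(Γ_{y,x}) = g(My) U(Γ_{y,x}) g(x)⁻¹`, where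
`My` is the corner of the block `y` of `x` (Bałaban CMP 95 (1984) (1.7); Dimock 2022 §2: "We use it
to parallel translate to the center of the cube before averaging, so that gauge covariance is
preserved"). [cite: Dimock2022QED3, §2] -/
theorem blockTransporter_gaugeTransform [Group G] [NeZero M] [NeZero L']
    (g : TorusSite d (M * L') → G) (U : GaugeConfig d (M * L') G) (x : TorusSite d (M * L')) :
    blockTransporter M L' (gaugeTransform g U) x =
      g (torusBlockCorner M L' (torusBlockOf M L' x)) * blockTransporter M L' U x * (g x)⁻¹ := by
  rw [blockTransporter, blockTransporter, transport_gaugeTransform, pathEnd_torusBlockPath]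

end TorusBlocks

/-! ### Gauge-covariant block averaging operators for lattice fermions -/

section CovariantAveraging

open Literature.Probability.LatticeModels QuantumFieldTheory

variable {d N : ℕ} (M L' : ℕ) {G : Type*} [Group G] (ρ : G →* Matrix (Fin N) (Fin N) ℂ)
  (σ : Type*) [Fintype σ] [DecidableEq σ]

/-- The **gauge rotation matrix** of a lattice gauge transformation `g` on fermion indices
(site, colour, spin): block diagonal, `ρ(g(x))` on colour and the identity on spin.  The fermions
transform as `ψ ↦ 𝒢(g) ψ`, `ψ̄ ↦ ψ̄ 𝒢(g)⁻¹` (Montvay–Münster §5.1; Seiler LNP 159 Ch. 3). [folklore] -/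
def gaugeRotation {X : Type*} [DecidableEq X] (g : X → G) : Matrix (X × Fin N × σ) (X × Fin N × σ) ℂ :=
  Matrix.of fun p q => if p.1 = q.1 then ρ (g p.1) p.2.1 q.2.1 * (1 : Matrix σ σ ℂ) p.2.2 q.2.2 else 0

/-- The **gauge-covariant block averaging operator** `Q(U)` for lattice fermions
(coarse index × fine index): `(Q(U)ψ)(y) = M^{-d} Σ_{x ∈ B(y)} ρ(U(Γ_{y,x})) ψ(x)`, the fermion at
`x` parallel-transported to the representative site of its block along the fixed path `Γ_{y,x}` and
averaged arithmetically over the `M^d` sites of the block; identity on the spin index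
(Bałaban–O'Carroll–Schor 1989, (1.1): `Q` "the arithmetic averaging operator over a block" for free
fermions; Dimock 2022, §2: `(Q(A)Ψ)(y) = L⁻³ Σ_{x ∈ B(y)} e^{ie A(Γ(y,x))} Ψ(x)` in the presence of a
gauge field). [cite: Dimock2022QED3, §2] -/
def fermionBlockAvg (U : GaugeConfig d (M * L') G) :
    Matrix (TorusSite d L' × Fin N × σ) (TorusSite d (M * L') × Fin N × σ) ℂ :=
  Matrix.of fun p q =>
    if torusBlockOf M L' q.1 = p.1 then
      ((M : ℂ) ^ d)⁻¹ * ρ (blockTransporter M L' U q.1) p.2.1 q.2.1 * (1 : Matrix σ σ ℂ) p.2.2 q.2.2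
    else 0

/-- The **conjugate block averaging operator** `Q̄(U)` acting on `ψ̄` from the right
(fine index × coarse index): `(ψ̄ Q̄(U))(y) = M^{-d} Σ_{x ∈ B(y)} ψ̄(x) ρ(U(Γ_{y,x}))⁻¹`, the
transporter being inverted because `ψ̄` carries the conjugate representation (Dimock 2022, §2:
`Q(-A) Ψ̄` pairs with `Q(A) Ψ`; for unitary `ρ` this is `Q(U)†`). [cite: Dimock2022QED3, §2] -/
def fermionBlockAvgBar (U : GaugeConfig d (M * L') G) :
    Matrix (TorusSite d (M * L') × Fin N × σ) (TorusSite d L' × Fin N × σ) ℂ :=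
  Matrix.of fun q p =>
    if torusBlockOf M L' q.1 = p.1 then
      ((M : ℂ) ^ d)⁻¹ * ρ (blockTransporter M L' U q.1)⁻¹ q.2.1 p.2.1 * (1 : Matrix σ σ ℂ) q.2.2 p.2.2
    else 0

variable {M L' σ}

omit [Fintype σ] in
/-- The gauge rotation of the trivial gauge transformation is the identity. [folklore] -/
@[simp] theorem gaugeRotation_one {X : Type*} [DecidableEq X] :
    gaugeRotation ρ σ (1 : X → G) = 1 := by
  ext p q
  simp only [gaugeRotation, Matrix.of_apply, Pi.one_apply, map_one, Matrix.one_apply, Prod.ext_iff]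
  by_cases h1 : p.1 = q.1 <;> by_cases h2 : p.2.1 = q.2.1 <;> by_cases h3 : p.2.2 = q.2.2 <;> simp [h1, h2, h3]

/-- Left multiplication by a gauge rotation acts on the colour index at fixed site and spin. [folklore] -/
theorem gaugeRotation_mul_apply {X Y : Type*} [Fintype X] [DecidableEq X] (g : X → G)
    (A : Matrix (X × Fin N × σ) Y ℂ) (p : X × Fin N × σ) (q : Y) :
    (gaugeRotation ρ σ g * A) p q = ∑ b, ρ (g p.1) p.2.1 b * A (p.1, b, p.2.2) q := by
  rw [Matrix.mul_apply, Fintype.sum_prod_type, Finset.sum_eq_single p.1]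
  · rw [Fintype.sum_prod_type]
    refine Finset.sum_congr rfl fun b _ => ?_
    rw [Finset.sum_eq_single p.2.2]
    · simp [gaugeRotation]
    · intro β _ hβ
      simp [gaugeRotation, Matrix.one_apply, Ne.symm hβ]
    · intro h; exact absurd (Finset.mem_univ _) h
  · intro x _ hx
    simp [gaugeRotation, Ne.symm hx]
  · intro h; exact absurd (Finset.mem_univ _) h

/-- Right multiplication by a gauge rotation acts on the colour index at fixed site and spin. [folklore] -/
theorem mul_gaugeRotation_apply {X Y : Type*} [Fintype X] [DecidableEq X] (g : X → G)
    (A : Matrix Y (X × Fin N × σ) ℂ) (p : Y) (q : X × Fin N × σ) :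
    (A * gaugeRotation ρ σ g) p q = ∑ a, A p (q.1, a, q.2.2) * ρ (g q.1) a q.2.1 := by
  rw [Matrix.mul_apply, Fintype.sum_prod_type, Finset.sum_eq_single q.1]
  · rw [Fintype.sum_prod_type]
    refine Finset.sum_congr rfl fun a _ => ?_
    rw [Finset.sum_eq_single q.2.2]
    · simp [gaugeRotation]
    · intro β _ hβ
      simp [gaugeRotation, Matrix.one_apply, hβ]
    · intro h; exact absurd (Finset.mem_univ _) h
  · intro x _ hx
    simp [gaugeRotation, hx]
  · intro h; exact absurd (Finset.mem_univ _) h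

/-- Gauge rotations multiply pointwise: `𝒢(g) 𝒢(h) = 𝒢(gh)`. [folklore] -/
theorem gaugeRotation_mul {X : Type*} [Fintype X] [DecidableEq X] (g h : X → G) :
    gaugeRotation ρ σ g * gaugeRotation ρ σ h = gaugeRotation ρ σ (g * h) := by
  ext p q
  rw [gaugeRotation_mul_apply]
  by_cases hpq : p.1 = q.1
  · simp only [gaugeRotation, Matrix.of_apply, hpq, if_true, Pi.mul_apply, map_mul, Matrix.mul_apply,
      Finset.sum_mul, mul_assoc]
  · simp [gaugeRotation, hpq]

/-- `𝒢(g⁻¹) 𝒢(g) = 1`. [folklore] -/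
theorem gaugeRotation_inv_mul {X : Type*} [Fintype X] [DecidableEq X] (g : X → G) :
    gaugeRotation ρ σ g⁻¹ * gaugeRotation ρ σ g = 1 := by
  rw [gaugeRotation_mul, inv_mul_cancel, gaugeRotation_one]

/-- `𝒢(g) 𝒢(g⁻¹) = 1`. [folklore] -/
theorem gaugeRotation_mul_inv {X : Type*} [Fintype X] [DecidableEq X] (g : X → G) :
    gaugeRotation ρ σ g * gaugeRotation ρ σ g⁻¹ = 1 := by
  rw [gaugeRotation_mul, mul_inv_cancel, gaugeRotation_one]

variable [NeZero M] [NeZero L']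

/-- **Gauge covariance of the block averaging operator**: `Q(U^g) = 𝒢'(g') Q(U) 𝒢(g)⁻¹` with the
coarse gauge transformation `g' = g ∘ (block corner)`, i.e. `Q(U^g)(𝒢(g)ψ) = 𝒢'(g')(Q(U)ψ)` —
block averages of gauge-transformed fermions are the gauge-transformed block averages
(Dimock 2022, §2; Bałaban CMP 95 (1984) (1.7) for the transporters). [cite: Dimock2022QED3, §2] -/
theorem fermionBlockAvg_gaugeTransform (g : TorusSite d (M * L') → G) (U : GaugeConfig d (M * L') G) :
    fermionBlockAvg M L' ρ σ (gaugeTransform g U) =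
      gaugeRotation ρ σ (g ∘ torusBlockCorner M L') * fermionBlockAvg M L' ρ σ U *
        gaugeRotation ρ σ g⁻¹ := by
  ext p q
  rw [mul_gaugeRotation_apply]
  simp_rw [gaugeRotation_mul_apply]
  by_cases h : torusBlockOf M L' q.1 = p.1
  · simp only [fermionBlockAvg, Matrix.of_apply, h, if_true, blockTransporter_gaugeTransform, map_mul,
      Function.comp_apply, Pi.inv_apply, Matrix.mul_apply, Finset.sum_mul, Finset.mul_sum]
    refine Finset.sum_congr rfl fun a _ => Finset.sum_congr rfl fun b _ => ?_
    ring
  · simp [fermionBlockAvg, h]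

/-- **Gauge covariance of the conjugate block averaging operator**:
`Q̄(U^g) = 𝒢(g) Q̄(U) 𝒢'(g')⁻¹`, `g' = g ∘ (block corner)` (Dimock 2022, §2). [cite: Dimock2022QED3, §2] -/
theorem fermionBlockAvgBar_gaugeTransform (g : TorusSite d (M * L') → G)
    (U : GaugeConfig d (M * L') G) :
    fermionBlockAvgBar M L' ρ σ (gaugeTransform g U) =
      gaugeRotation ρ σ g * fermionBlockAvgBar M L' ρ σ U *
        gaugeRotation ρ σ (g ∘ torusBlockCorner M L')⁻¹ := by
  ext q p
  rw [mul_gaugeRotation_apply]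
  simp_rw [gaugeRotation_mul_apply]
  by_cases h : torusBlockOf M L' q.1 = p.1
  · simp only [fermionBlockAvgBar, Matrix.of_apply, h, if_true, blockTransporter_gaugeTransform,
      _root_.mul_inv_rev, inv_inv, map_mul, Function.comp_apply, Pi.inv_apply, Matrix.mul_apply,
      Finset.sum_mul, Finset.mul_sum]
    refine Finset.sum_comm.trans (Finset.sum_congr rfl fun a _ => Finset.sum_congr rfl fun b _ => ?_)
    ring
  · simp [fermionBlockAvgBar, h]

end CovariantAveraging

/-! ### Gauge covariance of the Wilson–Dirac operator -/

section WilsonCovariance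

open Literature.Probability.LatticeModels QuantumFieldTheory

variable {L N : ℕ} {G : Type*} [Group G] (ρ : G →* Matrix (Fin N) (Fin N) ℂ)

/-- The forward hopping matrix of the Wilson action in direction `μ`:
`(x,a,α; y,b,β) ↦ [y = x + μ̂] (r - γ_μ)_{αβ} ρ(U(x,μ))_{ab}` (Montvay–Münster §4.2.2 (4.85), gauged as
in §5.1.1 (5.5), in the link orientation of the tree's `wilsonDirac`). [folklore] -/
def wilsonHopFwd (U : GaugeConfig 4 L G) (r : ℝ) (μ : Fin 4) :
    Matrix (TorusSite 4 L × Fin N × Fin 4) (TorusSite 4 L × Fin N × Fin 4) ℂ :=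
  Matrix.of fun p q =>
    if q.1 = QuantumFieldTheory.Site.shift p.1 μ then
      ((r : ℂ) • (1 : Matrix (Fin 4) (Fin 4) ℂ) - euclideanGamma μ) p.2.2 q.2.2 * ρ (U (p.1, μ)) p.2.1 q.2.1
    else 0

/-- The backward hopping matrix of the Wilson action in direction `μ`:
`(x,a,α; y,b,β) ↦ [x = y + μ̂] (r + γ_μ)_{αβ} ρ(U(y,μ)⁻¹)_{ab}` (Montvay–Münster §4.2.2 (4.85), §5.1.1
(5.5)). [folklore] -/
def wilsonHopBwd (U : GaugeConfig 4 L G) (r : ℝ) (μ : Fin 4) :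
    Matrix (TorusSite 4 L × Fin N × Fin 4) (TorusSite 4 L × Fin N × Fin 4) ℂ :=
  Matrix.of fun p q =>
    if p.1 = QuantumFieldTheory.Site.shift q.1 μ then
      ((r : ℂ) • (1 : Matrix (Fin 4) (Fin 4) ℂ) + euclideanGamma μ) p.2.2 q.2.2 * ρ (U (q.1, μ))⁻¹ p.2.1 q.2.1
    else 0

/-- The Wilson–Dirac operator as mass term minus half the sum of the hopping matrices:
`D_W = (m + 4r)·1 - ½ Σ_μ (H⁺_μ + H⁻_μ)` (Montvay–Münster §4.2.2 (4.85); a restatement of the tree's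
`wilsonDirac`). [folklore] -/
theorem wilsonDirac_eq (U : GaugeConfig 4 L G) (m r : ℝ) :
    wilsonDirac ρ U m r =
      ((m + 4 * r : ℝ) : ℂ) • (1 : Matrix (TorusSite 4 L × Fin N × Fin 4) (TorusSite 4 L × Fin N × Fin 4) ℂ) -
        (1 / 2 : ℂ) • ∑ μ : Fin 4, (wilsonHopFwd ρ U r μ + wilsonHopBwd ρ U r μ) := by
  ext p q
  simp only [wilsonDirac, wilsonHopFwd, wilsonHopBwd, Matrix.of_apply, Matrix.sub_apply,
    Matrix.smul_apply, Matrix.one_apply, smul_eq_mul, mul_ite, mul_one, mul_zero, Matrix.sum_apply,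
    Matrix.add_apply]

variable [NeZero L]

/-- Gauge covariance of the forward hopping matrix: `H⁺_μ(U^g) = 𝒢(g) H⁺_μ(U) 𝒢(g)⁻¹`. [folklore] -/
theorem wilsonHopFwd_gaugeTransform (g : TorusSite 4 L → G) (U : GaugeConfig 4 L G) (r : ℝ)
    (μ : Fin 4) :
    wilsonHopFwd ρ (gaugeTransform g U) r μ =
      gaugeRotation ρ (Fin 4) g * wilsonHopFwd ρ U r μ * gaugeRotation ρ (Fin 4) g⁻¹ := by
  ext p q
  rw [mul_gaugeRotation_apply]
  simp_rw [gaugeRotation_mul_apply]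
  by_cases h : q.1 = QuantumFieldTheory.Site.shift p.1 μ
  · simp only [wilsonHopFwd, Matrix.of_apply, h, if_true, gaugeTransform, map_mul, Pi.inv_apply,
      Matrix.mul_apply, Finset.sum_mul, Finset.mul_sum]
    rw [← h]
    refine Finset.sum_congr rfl fun a _ => Finset.sum_congr rfl fun b _ => ?_
    ring
  · simp [wilsonHopFwd, h]

/-- Gauge covariance of the backward hopping matrix: `H⁻_μ(U^g) = 𝒢(g) H⁻_μ(U) 𝒢(g)⁻¹`. [folklore] -/
theorem wilsonHopBwd_gaugeTransform (g : TorusSite 4 L → G) (U : GaugeConfig 4 L G) (r : ℝ)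
    (μ : Fin 4) :
    wilsonHopBwd ρ (gaugeTransform g U) r μ =
      gaugeRotation ρ (Fin 4) g * wilsonHopBwd ρ U r μ * gaugeRotation ρ (Fin 4) g⁻¹ := by
  ext p q
  rw [mul_gaugeRotation_apply]
  simp_rw [gaugeRotation_mul_apply]
  by_cases h : p.1 = QuantumFieldTheory.Site.shift q.1 μ
  · simp only [wilsonHopBwd, Matrix.of_apply, h, if_true, gaugeTransform, _root_.mul_inv_rev, inv_inv,
      map_mul, Pi.inv_apply, Matrix.mul_apply, Finset.sum_mul, Finset.mul_sum]
    rw [← h]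
    refine Finset.sum_comm.trans (Finset.sum_congr rfl fun a _ => Finset.sum_congr rfl fun b _ => ?_)
    ring
  · simp [wilsonHopBwd, h]

/-- **Gauge covariance of the Wilson–Dirac operator**: `D_W(U^g) = 𝒢(g) D_W(U) 𝒢(g)⁻¹`, i.e. the
Wilson quark action `ψ̄ D_W(U) ψ` is invariant under `ψ ↦ 𝒢(g)ψ`, `ψ̄ ↦ ψ̄𝒢(g)⁻¹`, `U ↦ U^g`
(Wilson 1975; Montvay–Münster §5.1.1, gauge invariance of the lattice QCD action (5.3)–(5.5)).
[folklore] -/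
theorem wilsonDirac_gaugeTransform (g : TorusSite 4 L → G) (U : GaugeConfig 4 L G) (m r : ℝ) :
    wilsonDirac ρ (gaugeTransform g U) m r =
      gaugeRotation ρ (Fin 4) g * wilsonDirac ρ U m r * gaugeRotation ρ (Fin 4) g⁻¹ := by
  rw [wilsonDirac_eq, wilsonDirac_eq]
  simp only [Matrix.mul_sub, Matrix.sub_mul, Matrix.mul_smul, Matrix.smul_mul, Matrix.mul_one,
    gaugeRotation_mul_inv, Matrix.mul_sum, Matrix.sum_mul, Matrix.mul_add, Matrix.add_mul,
    wilsonHopFwd_gaugeTransform, wilsonHopBwd_gaugeTransform]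

end WilsonCovariance


/-! ### The block RG transformation as an exact Grassmann–Gaussian integration -/

section GrassmannRG

open ExteriorAlgebra GrassmannAlgebra

variable (R : Type*) [CommRing R] {m n : Type*} [LinearOrder m] [Fintype m] [LinearOrder n]
  [Fintype n]

/-- The index type of the joint Grassmann algebra of one block RG step: the block (coarse)
fermions `χ̄, χ` (indexed by `n ⊕ₗ n`) are placed BEFORE the integrated (fine) fermions `ψ̄, ψ`
(indexed by `m ⊕ₗ m`), all `ψ̄`/`χ̄` before `ψ`/`χ` inside each block as in `GrassmannIntegral.lean`.
[folklore] -/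
abbrev BlockRGIdx (n m : Type*) [LinearOrder n] [LinearOrder m] : Type _ := (n ⊕ₗ n) ⊕ₗ (m ⊕ₗ m)

variable {R} in
/-- The block fermion `χ̄_y` in the joint algebra. [folklore] -/
abbrev chiBar (y : n) : GrassmannAlgebra R (BlockRGIdx n m) :=
  gen R (inlLex (n ⊕ₗ n) (m ⊕ₗ m) (toLex (Sum.inl y)))

variable {R} in
/-- The block fermion `χ_y` in the joint algebra. [folklore] -/
abbrev chi (y : n) : GrassmannAlgebra R (BlockRGIdx n m) :=
  gen R (inlLex (n ⊕ₗ n) (m ⊕ₗ m) (toLex (Sum.inr y)))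

variable {R} in
/-- The fine fermion `ψ̄_x` in the joint algebra. [folklore] -/
abbrev psiBarF (x : m) : GrassmannAlgebra R (BlockRGIdx n m) :=
  gen R (inrLex (n ⊕ₗ n) (m ⊕ₗ m) (toLex (Sum.inl x)))

variable {R} in
/-- The fine fermion `ψ_x` in the joint algebra. [folklore] -/
abbrev psiF (x : m) : GrassmannAlgebra R (BlockRGIdx n m) :=
  gen R (inrLex (n ⊕ₗ n) (m ⊕ₗ m) (toLex (Sum.inr x)))

/-- The exponent `-a Σ_y (χ̄_y - (ψ̄Q̄)_y)(χ_y - (Qψ)_y)` of the Gaussian block-spin weight coupling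
the block fermions `χ̄, χ` to the block averages `ψ̄Q̄`, `Qψ` of the fine fermions
(Bałaban–O'Carroll–Schor 1989, (1.1): `exp[-a (Lε)^{-1} (χ̄ - φ̄Q⁺, χ - Qφ)]`; Dimock 2022, §2:
`exp(-(b/L) ⟨Ψ̄₁ - Q(-A)Ψ̄₀, Ψ₁ - Q(A)Ψ₀⟩)`; the lattice-spacing weights of their Riemann-sum inner
products are absorbed into `a`). [cite: BalabanOcarrollSchor1989, §I (1.1)] -/
def blockRGExponent (a : R) (Q : Matrix n m R) (Qb : Matrix m n R) :
    GrassmannAlgebra R (BlockRGIdx n m) :=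
  -(a • ∑ y, (chiBar (m := m) y - ∑ x, Qb x y • psiBarF x) * (chi (m := m) y - ∑ x, Q y x • psiF x))

/-- The Gaussian **block-spin weight** `exp (-a Σ_y (χ̄_y - (ψ̄Q̄)_y)(χ_y - (Qψ)_y))` of one
fermionic block RG step (Bałaban–O'Carroll–Schor 1989, (1.1); Dimock 2022, §2: "We have avoided
using a delta function for the fermion fields (which would not work for Grassmann elements) and
instead used a Gaussian factor"). [cite: BalabanOcarrollSchor1989, §I (1.1)] -/
def blockRGWeight (a : R) (Q : Matrix n m R) (Qb : Matrix m n R) [Algebra ℚ R] :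
    GrassmannAlgebra R (BlockRGIdx n m) :=
  grassmannExp (blockRGExponent R a Q Qb)

/-- **The fermionic block renormalisation group transformation** `T_{a,Q}` on densities
(Bałaban–O'Carroll–Schor 1989, (1.1); Dimock 2022, §2, the map `ρ₀ ↦ ρ̃₁`):
`(T ρ)(χ̄, χ) = ∫ dψ̄ dψ exp (-a Σ_y (χ̄_y - (ψ̄Q̄)_y)(χ_y - (Qψ)_y)) ρ(ψ̄, ψ)`,
an `R`-linear map from the Grassmann algebra of the fine fermions (`m ⊕ₗ m`: `ψ̄` before `ψ`) to
that of the block fermions (`n ⊕ₗ n`).  Implementation: embed `ρ` into the joint algebra on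
`BlockRGIdx n m` (fine block second), multiply by the (even, hence central) weight
`blockRGWeight`, integrate out the fine variables with `berezinOn`, and read off the result in the
algebra of the block fermions through the restriction map along `inlLex` (a left inverse of the
embedding, killing the fine generators, cf. `funLeft_comp_extendByZero`).  The normalisation
constant `N` of loc. cit. (1.2) is NOT included. [cite: BalabanOcarrollSchor1989, §I (1.1)] -/
def fermionBlockRG [Algebra ℚ R] (a : R) (Q : Matrix n m R) (Qb : Matrix m n R) :
    GrassmannAlgebra R (m ⊕ₗ m) →ₗ[R] GrassmannAlgebra R (n ⊕ₗ n) :=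
  (ExteriorAlgebra.map (LinearMap.funLeft R R (inlLex (n ⊕ₗ n) (m ⊕ₗ m)))).toLinearMap ∘ₗ
    berezinOn R (Finset.univ.map (inrLex (n ⊕ₗ n) (m ⊕ₗ m)).toEmbedding) ∘ₗ
      LinearMap.mulLeft R (blockRGWeight R a Q Qb) ∘ₗ
        (ExteriorAlgebra.map
          (Function.ExtendByZero.linearMap R (inrLex (n ⊕ₗ n) (m ⊕ₗ m)))).toLinearMap

/-- Unfolding `fermionBlockRG`. [folklore] -/
theorem fermionBlockRG_apply [Algebra ℚ R] (a : R) (Q : Matrix n m R) (Qb : Matrix m n R)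
    (ρ : GrassmannAlgebra R (m ⊕ₗ m)) :
    fermionBlockRG R a Q Qb ρ =
      ExteriorAlgebra.map (LinearMap.funLeft R R (inlLex (n ⊕ₗ n) (m ⊕ₗ m)))
        (berezinOn R (Finset.univ.map (inrLex (n ⊕ₗ n) (m ⊕ₗ m)).toEmbedding)
          (blockRGWeight R a Q Qb *
            ExteriorAlgebra.map (Function.ExtendByZero.linearMap R (inrLex (n ⊕ₗ n) (m ⊕ₗ m))) ρ)) :=
  rfl

/-! #### Bookkeeping in the joint algebra -/

omit [Fintype m] [Fintype n] in
/-- The restriction along `inlLex` is a left inverse of the embedding of the block-fermion algebra.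
[folklore] -/
theorem map_funLeft_map_extendByZero_inlLex (z : GrassmannAlgebra R (n ⊕ₗ n)) :
    ExteriorAlgebra.map (LinearMap.funLeft R R (inlLex (n ⊕ₗ n) (m ⊕ₗ m)))
        (ExteriorAlgebra.map (Function.ExtendByZero.linearMap R (inlLex (n ⊕ₗ n) (m ⊕ₗ m))) z) =
      z := by
  rw [← AlgHom.comp_apply, ExteriorAlgebra.map_comp_map,
    funLeft_comp_extendByZero R (inlLex (n ⊕ₗ n) (m ⊕ₗ m)).injective, ExteriorAlgebra.map_id,
    AlgHom.id_apply]

omit [Fintype n] in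
/-- The embedded fine quadratic action in the joint algebra: `e_*(ψ̄Bψ) = Σ B_{xx'} ψ̄_x ψ_{x'}`.
[folklore] -/
theorem map_inrLex_quadratic (B : Matrix m m R) :
    ExteriorAlgebra.map (Function.ExtendByZero.linearMap R (inrLex (n ⊕ₗ n) (m ⊕ₗ m)))
        (quadratic R B) =
      ∑ x, ∑ x', B x x' • (psiBarF (n := n) x * psiF x') := by
  simp only [quadratic, map_sum, map_smul, map_mul, psiBar, psi, map_extendByZero_gen']

omit [Fintype m] in
/-- The embedded block quadratic action in the joint algebra: `e_*(χ̄Bχ) = Σ B_{yy'} χ̄_y χ_{y'}`.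
[folklore] -/
theorem map_inlLex_quadratic (B : Matrix n n R) :
    ExteriorAlgebra.map (Function.ExtendByZero.linearMap R (inlLex (n ⊕ₗ n) (m ⊕ₗ m)))
        (quadratic R B) =
      ∑ y, ∑ y', B y y' • (chiBar (m := m) y * chi y') := by
  simp only [quadratic, map_sum, map_smul, map_mul, psiBar, psi, map_extendByZero_gen']

/-- The source vector of `ψ_x` generated by the block fermions: `Σ_y a Q_{yx} e_{χ̄_y}`, so that
`ι(v̄_x) = a Σ_y Q_{yx} χ̄_y = a (χ̄Q)_x`. [folklore] -/
def blockSrcBar (a : R) (Q : Matrix n m R) (x : m) : BlockRGIdx n m → R :=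
  ∑ y, (a * Q y x) • (Pi.single (inlLex (n ⊕ₗ n) (m ⊕ₗ m) (toLex (Sum.inl y))) 1 : BlockRGIdx n m → R)

/-- The source vector of `ψ̄_x` generated by the block fermions: `Σ_y a Q̄_{xy} e_{χ_y}`, so that
`ι(v_x) = a Σ_y Q̄_{xy} χ_y = a (Q̄χ)_x`. [folklore] -/
def blockSrc (a : R) (Qb : Matrix m n R) (x : m) : BlockRGIdx n m → R :=
  ∑ y, (a * Qb x y) • (Pi.single (inlLex (n ⊕ₗ n) (m ⊕ₗ m) (toLex (Sum.inr y))) 1 : BlockRGIdx n m → R)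

omit [Fintype m] in
/-- `ι(v̄_x) = Σ_y a Q_{yx} χ̄_y`. [folklore] -/
theorem ι_blockSrcBar (a : R) (Q : Matrix n m R) (x : m) :
    ExteriorAlgebra.ι R (blockSrcBar R a Q x) = ∑ y, (a * Q y x) • chiBar (m := m) y := by
  simp only [blockSrcBar, map_sum, map_smul, chiBar, gen]

omit [Fintype m] in
/-- `ι(v_x) = Σ_y a Q̄_{xy} χ_y`. [folklore] -/
theorem ι_blockSrc (a : R) (Qb : Matrix m n R) (x : m) :
    ExteriorAlgebra.ι R (blockSrc R a Qb x) = ∑ y, (a * Qb x y) • chi (m := m) y := by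
  simp only [blockSrc, map_sum, map_smul, chi, gen]

omit [Fintype m] [Fintype n] in
/-- Block and fine generators have distinct indices in the joint algebra. [folklore] -/
theorem inlLex_ne_inrLex (j : n ⊕ₗ n) (k : m ⊕ₗ m) :
    inlLex (n ⊕ₗ n) (m ⊕ₗ m) j ≠ inrLex (n ⊕ₗ n) (m ⊕ₗ m) k := by
  intro h
  rcases toLex_inj.1 h with ⟨⟩

omit [Fintype m] in
/-- The source vectors are supported on the block-fermion indices. [folklore] -/
theorem blockSrcBar_apply_inrLex (a : R) (Q : Matrix n m R) (x : m) (k : m ⊕ₗ m) :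
    blockSrcBar R a Q x (inrLex (n ⊕ₗ n) (m ⊕ₗ m) k) = 0 := by
  simp only [blockSrcBar, Finset.sum_apply, Pi.smul_apply, Pi.single_apply,
    (inlLex_ne_inrLex _ k).symm, if_false, smul_zero, Finset.sum_const_zero]

omit [Fintype m] in
/-- The source vectors are supported on the block-fermion indices. [folklore] -/
theorem blockSrc_apply_inrLex (a : R) (Qb : Matrix m n R) (x : m) (k : m ⊕ₗ m) :
    blockSrc R a Qb x (inrLex (n ⊕ₗ n) (m ⊕ₗ m) k) = 0 := by
  simp only [blockSrc, Finset.sum_apply, Pi.smul_apply, Pi.single_apply,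
    (inlLex_ne_inrLex _ k).symm, if_false, smul_zero, Finset.sum_const_zero]

/-- **Expansion of the block-spin exponent** into the normal form of the Gaussian integral with
sources: `-a Σ_y (χ̄_y - (ψ̄Q̄)_y)(χ_y - (Qψ)_y) = -a ψ̄ Q̄Q ψ + Σ_x (a(χ̄Q)_x ψ_x + ψ̄_x a(Q̄χ)_x) - a χ̄χ`
(Bałaban–O'Carroll–Schor 1989, proof of Lemma II.1: "equate the coefficients of the quadratic
form"). [cite: BalabanOcarrollSchor1989, §II Lemma II.1] -/
theorem blockRGExponent_eq (a : R) (Q : Matrix n m R) (Qb : Matrix m n R) :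
    blockRGExponent R a Q Qb =
      ExteriorAlgebra.map (Function.ExtendByZero.linearMap R (inrLex (n ⊕ₗ n) (m ⊕ₗ m)))
          (quadratic R (-(a • (Qb * Q)))) +
        ∑ x, (ExteriorAlgebra.ι R (blockSrcBar R a Q x) * psiF x +
          psiBarF x * ExteriorAlgebra.ι R (blockSrc R a Qb x)) +
        ExteriorAlgebra.map (Function.ExtendByZero.linearMap R (inlLex (n ⊕ₗ n) (m ⊕ₗ m)))
          (quadratic R (-(a • (1 : Matrix n n R)))) := by
  -- the three cross/diagonal terms
  have e1 : a • ∑ y, chiBar (m := m) y * ∑ x, Q y x • psiF (R := R) x =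
      ∑ x, ExteriorAlgebra.ι R (blockSrcBar R a Q x) * psiF x := by
    simp only [ι_blockSrcBar, Finset.mul_sum, Finset.sum_mul, mul_smul_comm, smul_mul_assoc,
      Finset.smul_sum, smul_smul]
    exact Finset.sum_comm
  have e2 : a • ∑ y, (∑ x, Qb x y • psiBarF (R := R) x) * chi (m := m) y =
      ∑ x, psiBarF x * ExteriorAlgebra.ι R (blockSrc R a Qb x) := by
    simp only [ι_blockSrc, Finset.mul_sum, Finset.sum_mul, mul_smul_comm, smul_mul_assoc,
      Finset.smul_sum, smul_smul]
    exact Finset.sum_comm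
  have e3 : a • ∑ y, (∑ x, Qb x y • psiBarF (R := R) (n := n) x) * ∑ x', Q y x' • psiF x' =
      ∑ x, ∑ x', (a • (Qb * Q)) x x' • (psiBarF (n := n) x * psiF x') := by
    simp only [Finset.sum_mul_sum, smul_mul_smul_comm, Finset.smul_sum, smul_smul]
    simp only [Matrix.smul_apply, Matrix.mul_apply, smul_eq_mul, Finset.mul_sum, Finset.sum_smul]
    rw [Finset.sum_comm]
    refine Finset.sum_congr rfl fun x _ => ?_
    rw [Finset.sum_comm]
  have e4 : ExteriorAlgebra.map (Function.ExtendByZero.linearMap R (inlLex (n ⊕ₗ n) (m ⊕ₗ m)))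
      (quadratic R (-(a • (1 : Matrix n n R)))) = -(a • ∑ y, chiBar (m := m) y * chi y) := by
    rw [map_inlLex_quadratic]
    simp only [Matrix.neg_apply, Matrix.smul_apply, Matrix.one_apply, smul_eq_mul, mul_ite, mul_one,
      mul_zero, neg_smul, ite_smul, zero_smul, Finset.sum_neg_distrib, Finset.smul_sum]
    congr 1
    refine Finset.sum_congr rfl fun y _ => ?_
    rw [Finset.sum_ite_eq, if_pos (Finset.mem_univ y)]
  rw [e4, map_inrLex_quadratic, Finset.sum_add_distrib, ← e1, ← e2]
  simp only [Matrix.neg_apply, neg_smul, Finset.sum_neg_distrib]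
  rw [← e3, blockRGExponent]
  simp only [sub_mul, mul_sub, Finset.sum_sub_distrib, smul_sub]
  abel

/-- The recombination of the sources after the fine Gaussian integration:
`Σ_{xx'} C_{xx'} (a(χ̄Q)_x)(a(Q̄χ)_{x'}) = e_*(χ̄ (a² Q C Q̄) χ)`. [folklore] -/
theorem sum_smul_ι_blockSrcBar_mul_ι_blockSrc (a : R) (Q : Matrix n m R) (Qb : Matrix m n R)
    (C : Matrix m m R) :
    ∑ x, ∑ x', C x x' •
        (ExteriorAlgebra.ι R (blockSrcBar R a Q x) * ExteriorAlgebra.ι R (blockSrc R a Qb x')) =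
      ExteriorAlgebra.map (Function.ExtendByZero.linearMap R (inlLex (n ⊕ₗ n) (m ⊕ₗ m)))
        (quadratic R (a ^ 2 • (Q * C * Qb))) := by
  rw [map_inlLex_quadratic]
  simp only [ι_blockSrcBar, ι_blockSrc, Finset.sum_mul_sum, smul_mul_smul_comm, Finset.smul_sum,
    smul_smul]
  simp only [Matrix.smul_apply, Matrix.mul_apply, smul_eq_mul, Finset.mul_sum, Finset.sum_mul,
    Finset.sum_smul]
  -- LHS: Σ_x Σ_x' Σ_y Σ_y' ;  RHS: Σ_y Σ_y' Σ_x' Σ_x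
  calc ∑ x, ∑ x', ∑ y, ∑ y', (C x x' * (a * Q y x * (a * Qb x' y'))) • (chiBar (m := m) y * chi y')
      = ∑ x, ∑ y, ∑ x', ∑ y', (C x x' * (a * Q y x * (a * Qb x' y'))) • (chiBar (m := m) y * chi y') :=
        Finset.sum_congr rfl fun _ _ => Finset.sum_comm
    _ = ∑ y, ∑ x, ∑ x', ∑ y', (C x x' * (a * Q y x * (a * Qb x' y'))) • (chiBar (m := m) y * chi y') :=
        Finset.sum_comm
    _ = ∑ y, ∑ x, ∑ y', ∑ x', (C x x' * (a * Q y x * (a * Qb x' y'))) • (chiBar (m := m) y * chi y') :=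
        Finset.sum_congr rfl fun _ _ => Finset.sum_congr rfl fun _ _ => Finset.sum_comm
    _ = ∑ y, ∑ y', ∑ x, ∑ x', (C x x' * (a * Q y x * (a * Qb x' y'))) • (chiBar (m := m) y * chi y') :=
        Finset.sum_congr rfl fun _ _ => Finset.sum_comm
    _ = ∑ y, ∑ y', ∑ x', ∑ x, (C x x' * (a * Q y x * (a * Qb x' y'))) • (chiBar (m := m) y * chi y') :=
        Finset.sum_congr rfl fun _ _ => Finset.sum_congr rfl fun _ _ => Finset.sum_comm
    _ = _ := by
        refine Finset.sum_congr rfl fun y _ => Finset.sum_congr rfl fun y' _ =>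
          Finset.sum_congr rfl fun x' _ => Finset.sum_congr rfl fun x _ => ?_
        ring_nf

variable [Algebra ℚ R]

/-- **The fermionic block RG step is an exact Grassmann–Gaussian integration**
(Bałaban–O'Carroll–Schor 1989, (1.1) and §II, Lemma II.2 — "Performing the integral gives the
result", with `∫ dφ̄ dφ exp[(φ̄,Aφ) + (J̄,φ) + (φ̄,J)] = det A e^{-(J̄,A⁻¹J)}`; Dimock 2022, §2):
for a Gaussian density `exp (-ψ̄ D ψ)` and any averaging data `a, Q, Q̄` with invertible fluctuation
operator `F = D + aQ̄Q`,
`T_{a,Q}(e^{-ψ̄Dψ})(χ̄, χ) = ∫ dψ̄dψ e^{-a(χ̄-ψ̄Q̄)(χ-Qψ)} e^{-ψ̄Dψ} = ε det(-F) · e^{-χ̄ D₁ χ}`,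
with the block Dirac operator `D₁ = a - a² Q F⁻¹ Q̄` (`blockDirac`) and the orientation sign
`ε = (-1)^{|m|(|m|-1)/2}` of the tree's Berezin integral (`berezin_grassmannExp_quadratic`).
Proof: expand the exponent (`blockRGExponent_eq`), apply the Gaussian Berezin integral with sources
`GrassmannGaussianSources.berezinOn_grassmannExp_quadratic_add_sources` (Salmhofer 1999, Lemma B.6)
to the fine variables with `A = -F`, and recombine `-J̄A⁻¹J - aχ̄χ = -χ̄D₁χ`. [cite: BalabanOcarrollSchor1989, §II Lemma II.2] -/
theorem fermionBlockRG_grassmannExp_quadratic (a : R) (Q : Matrix n m R) (Qb : Matrix m n R)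
    (D : Matrix m m R) (hF : IsUnit (fluctuationOp a Q Qb D).det) :
    fermionBlockRG R a Q Qb (grassmannExp (quadratic R (-D))) =
      ((-1 : R) ^ (Fintype.card m * (Fintype.card m - 1) / 2) * (-fluctuationOp a Q Qb D).det) •
        grassmannExp (quadratic R (-blockDirac a Q Qb D)) := by
  -- notation
  set eC := inlLex (n ⊕ₗ n) (m ⊕ₗ m) with heC
  set eF := inrLex (n ⊕ₗ n) (m ⊕ₗ m) with heF
  set F := fluctuationOp a Q Qb D with hFdef
  set sF : Finset (BlockRGIdx n m) := Finset.univ.map eF.toEmbedding with hsF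
  set ΦF := ExteriorAlgebra.map (Function.ExtendByZero.linearMap R eF) with hΦF
  set ΦC := ExteriorAlgebra.map (Function.ExtendByZero.linearMap R eC) with hΦC
  set S : GrassmannAlgebra R (BlockRGIdx n m) :=
    ∑ x, (ExteriorAlgebra.ι R (blockSrcBar R a Q x) * gen R (eF (toLex (Sum.inr x))) +
      gen R (eF (toLex (Sum.inl x))) * ExteriorAlgebra.ι R (blockSrc R a Qb x)) with hS
  set Cq : GrassmannAlgebra R (BlockRGIdx n m) := ΦC (quadratic R (-(a • (1 : Matrix n n R)))) with hCq
  -- units and inverses of `A = -F`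
  have hAunit : IsUnit (-F).det := by
    rw [Matrix.det_neg]; exact ((isUnit_one.neg).pow _).mul hF
  have hAinv : (-F)⁻¹ = -F⁻¹ := by
    refine Matrix.inv_eq_left_inv ?_
    rw [neg_mul_neg, Matrix.nonsing_inv_mul _ hF]
  -- centrality of embedded quadratic forms
  have hcF : ∀ (B : Matrix m m R) (z), Commute (ΦF (quadratic R B)) z := fun B z =>
    commute_map_quadratic R ΦF B (fun x y z => by
      rw [hΦF, gen, gen, ExteriorAlgebra.map_apply_ι, ExteriorAlgebra.map_apply_ι]
      exact commute_ι_mul_ι _ _ z) z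
  have hcC : ∀ (B : Matrix n n R) (z), Commute (ΦC (quadratic R B)) z := fun B z =>
    commute_map_quadratic R ΦC B (fun x y z => by
      rw [hΦC, gen, gen, ExteriorAlgebra.map_apply_ι, ExteriorAlgebra.map_apply_ι]
      exact commute_ι_mul_ι _ _ z) z
  have hnF : ∀ B : Matrix m m R, IsNilpotent (ΦF (quadratic R B)) := fun B =>
    (isNilpotent_quadratic R B).map _
  have hnC : ∀ B : Matrix n n R, IsNilpotent (ΦC (quadratic R B)) := fun B =>
    (isNilpotent_quadratic R B).map _
  have hnS : IsNilpotent S := by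
    refine Commute.isNilpotent_sum (fun i _ => ?_) fun i j _ _ => ?_
    · refine Commute.isNilpotent_add ?_ ⟨2, ?_⟩ ⟨2, ?_⟩
      · exact commute_ι_mul_ι _ _ _
      · rw [pow_two]; exact ι_mul_ι_mul_self _ _
      · rw [pow_two]; exact ι_mul_ι_mul_self _ _
    · exact Commute.add_left (commute_ι_mul_ι _ _ _) (commute_ι_mul_ι _ _ _)
  -- Step 1: the integrand is `exp (Φ_F(quadratic(-F)) + S) * exp Cq`
  have hY : IsNilpotent (ΦF (quadratic R (-F)) + S) :=
    Commute.isNilpotent_add (hcF _ _) (hnF _) hnS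
  have h1 : blockRGWeight R a Q Qb * ΦF (grassmannExp (quadratic R (-D))) =
      grassmannExp (ΦF (quadratic R (-F)) + S) * grassmannExp Cq := by
    have hq : IsNilpotent (quadratic R (-D)) := isNilpotent_quadratic R _
    rw [grassmannExp, IsNilpotent.map_exp hq ΦF, blockRGWeight, blockRGExponent_eq, grassmannExp,
      grassmannExp, grassmannExp, ← IsNilpotent.exp_add_of_commute ((hcC _ _).symm) hY (hnC _),
      ← IsNilpotent.exp_add_of_commute ((hcF _ _).symm) _ (hnF _)]
    · congr 1
      simp only [hΦF, hΦC, heF, heC, hFdef, fluctuationOp, neg_add, quadratic_add, map_add, psiF,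
        psiBarF]
      abel
    · exact Commute.isNilpotent_add ((hcC _ _).symm)
        (Commute.isNilpotent_add (hcF _ _) (hnF _) hnS) (hnC _)
  -- Step 2: Gaussian integral with sources over the fine variables
  have h2 : berezinOn R sF (grassmannExp (ΦF (quadratic R (-F)) + S)) =
      ((-1 : R) ^ (Fintype.card m * (Fintype.card m - 1) / 2) * (-F).det) •
        grassmannExp (-∑ x, ∑ x', (-F)⁻¹ x x' •
          (ExteriorAlgebra.ι R (blockSrcBar R a Q x) * ExteriorAlgebra.ι R (blockSrc R a Qb x'))) :=
    berezinOn_grassmannExp_quadratic_add_sources R eF (-F) hAunit (blockSrcBar R a Q) (blockSrc R a Qb)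
      (fun x k => blockSrcBar_apply_inrLex R a Q x k) (fun x k => blockSrc_apply_inrLex R a Qb x k)
  -- Step 3: the spectator `exp Cq` factors out of the fine integral
  have hsF : ∀ k, eC k ∉ sF := by
    intro k hk
    obtain ⟨j, -, hj⟩ := Finset.mem_map.1 hk
    exact inlLex_ne_inrLex (m := m) (n := n) k j hj.symm
  have hCmem : grassmannExp Cq ∈ spectatorSubalgebra R sF := by
    rw [hCq, grassmannExp, ← IsNilpotent.map_exp (isNilpotent_quadratic R _) ΦC]
    exact map_extendByZero_mem_spectatorSubalgebra R eC hsF _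
  have hCcomm : ∀ z, Commute (grassmannExp Cq) z :=
    commute_exp_of_forall_commute (hcC _) (hnC _)
  -- Step 4: recombination of the exponent
  have h4 : -∑ x, ∑ x', (-F)⁻¹ x x' •
        (ExteriorAlgebra.ι R (blockSrcBar R a Q x) * ExteriorAlgebra.ι R (blockSrc R a Qb x')) + Cq =
      ΦC (quadratic R (-blockDirac a Q Qb D)) := by
    rw [hAinv, sum_smul_ι_blockSrcBar_mul_ι_blockSrc, hCq, ← map_neg, ← map_add, ← quadratic_neg,
      ← quadratic_add]
    congr 2
    rw [blockDirac, ← hFdef, neg_sub, sub_eq_add_neg, Matrix.mul_neg, Matrix.neg_mul, smul_neg, neg_neg]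
  have hT : IsNilpotent (-∑ x, ∑ x', (-F)⁻¹ x x' •
      (ExteriorAlgebra.ι R (blockSrcBar R a Q x) * ExteriorAlgebra.ι R (blockSrc R a Qb x'))) :=
    (isNilpotent_sum_sum_smul_ι_mul_ι _ _ _).neg
  -- assemble
  rw [fermionBlockRG_apply, h1, berezinOn_mul_of_mem_spectatorSubalgebra_of_commute R hCmem hCcomm,
    h2, smul_mul_assoc, grassmannExp, grassmannExp,
    ← IsNilpotent.exp_add_of_commute ((hcC _ _).symm) hT (hnC _), h4,
    ← IsNilpotent.map_exp (isNilpotent_quadratic R _) ΦC, map_smul, hΦC, heC,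
    map_funLeft_map_extendByZero_inlLex]
  rfl

end GrassmannRG

/-! ### Wilson fermions: the block averaging scheme for lattice QCD-type theories -/

section Wilson

open Literature.Probability.LatticeModels QuantumFieldTheory GrassmannAlgebra

/-- **Gauge-covariant block averaging for Wilson fermions** — the data of the fermionic block
renormalisation group of Bałaban–O'Carroll–Schor (CMP 122 (1989), (1.1) and §II) in the
gauge-covariant form of Dimock (2022, §2), for lattice Dirac (Wilson) fermions in a background
lattice gauge field on the four-dimensional torus: the block side `M` and the Gaussian parameter
`a > 0` of the block-spin weight `exp (-a Σ_y (χ̄_y - (ψ̄Q̄(U))_y)(χ_y - (Q(U)ψ)_y))`.  Everything else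
is DERIVED in the namespace `WilsonFermionBlockAveraging`: the covariant averaging operators
`sch.avg ρ U = Q(U)`, `sch.avgBar ρ U = Q̄(U)` (`fermionBlockAvg`, transport to the block corner along
the fixed coordinate-ordered path, `blockTransporter`), the fluctuation operator
`F(U) = D_W(U) + aQ̄Q`, the block Dirac operator `D₁(U) = a - a²QF⁻¹Q̄` over the tree's `wilsonDirac ρ U m r`
(`sch.blockDirac`), its propagator and determinant factor, the RG transformation on Grassmann
densities (`sch.transform`, an instance of `fermionBlockRG`) and the exact Gaussian step
(`transform_grassmannExp_wilsonDirac`).  One step maps the torus of side `M·L'` to the torus of side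
`L'`; iterating is re-instantiating at `L' = M·L''` (`D_j ↦ D_{j+1}`, loc. cit. (1.3), Lemma II.3).
[cite: BalabanOcarrollSchor1989, §I (1.1)] -/
structure WilsonFermionBlockAveraging where
  /-- The block side (`L` in Bałaban–O'Carroll–Schor 1989 and Dimock 2022). -/
  M : ℕ
  /-- Blocks are non-trivial: `2 ≤ M`. -/
  two_le_M : 2 ≤ M
  /-- The Gaussian parameter of the block-spin weight (`a (Lε)⁻¹` in BOS (1.1), `b/L` in Dimock 2022,
  §2), absorbing the lattice-spacing weights of the inner products. -/
  a : ℝ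
  /-- The Gaussian parameter is positive. -/
  a_pos : 0 < a

namespace WilsonFermionBlockAveraging

variable (sch : WilsonFermionBlockAveraging) {L' N : ℕ} {G : Type*} [Group G]
  (ρ : G →* Matrix (Fin N) (Fin N) ℂ)

/-- The block side of a scheme is non-zero. [folklore] -/
instance neZero_M : NeZero sch.M := ⟨by have := sch.two_le_M; omega⟩

/-- The Gaussian parameter, as a complex number, is a unit. [folklore] -/
theorem isUnit_a : IsUnit (sch.a : ℂ) :=
  isUnit_iff_ne_zero.2 (Complex.ofReal_ne_zero.2 sch.a_pos.ne')

/-- The covariant block averaging operator `Q(U)` of the scheme for four-dimensional lattice Dirac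
fermions (spin index `Fin 4`) in the representation `ρ` (Dimock 2022, §2; BOS 1989 (1.1)).
[cite: Dimock2022QED3, §2] -/
def avg (U : GaugeConfig 4 (sch.M * L') G) :
    Matrix (TorusSite 4 L' × Fin N × Fin 4) (TorusSite 4 (sch.M * L') × Fin N × Fin 4) ℂ :=
  fermionBlockAvg sch.M L' ρ (Fin 4) U

/-- The conjugate block averaging operator `Q̄(U)` of the scheme (Dimock 2022, §2). [cite: Dimock2022QED3, §2] -/
def avgBar (U : GaugeConfig 4 (sch.M * L') G) :
    Matrix (TorusSite 4 (sch.M * L') × Fin N × Fin 4) (TorusSite 4 L' × Fin N × Fin 4) ℂ :=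
  fermionBlockAvgBar sch.M L' ρ (Fin 4) U

variable [NeZero L']

/-- The fluctuation operator `F(U) = D_W(U; m, r) + a Q̄(U) Q(U)` of one block step for Wilson
fermions of bare mass `m` and Wilson parameter `r` in the background `U` (BOS 1989, (2.3)).
[cite: BalabanOcarrollSchor1989, §II (2.3)] -/
def fluctuationOp (U : GaugeConfig 4 (sch.M * L') G) (m r : ℝ) :
    Matrix (TorusSite 4 (sch.M * L') × Fin N × Fin 4) (TorusSite 4 (sch.M * L') × Fin N × Fin 4) ℂ :=
  QuantumLattice.fluctuationOp (sch.a : ℂ) (sch.avg ρ U) (sch.avgBar ρ U) (wilsonDirac ρ U m r)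

/-- **The block Wilson–Dirac operator** `D₁(U) = a - a² Q(U) (D_W(U) + aQ̄(U)Q(U))⁻¹ Q̄(U)` on the
coarse torus after one gauge-covariant block RG step (BOS 1989, Lemma II.2–II.3; Dimock 2022, §2).
[cite: BalabanOcarrollSchor1989, §II Lemma II.2–II.3] -/
def blockDirac (U : GaugeConfig 4 (sch.M * L') G) (m r : ℝ) :
    Matrix (TorusSite 4 L' × Fin N × Fin 4) (TorusSite 4 L' × Fin N × Fin 4) ℂ :=
  QuantumLattice.blockDirac (sch.a : ℂ) (sch.avg ρ U) (sch.avgBar ρ U) (wilsonDirac ρ U m r)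

/-- The block propagator `D₁(U)⁻¹` (BOS 1989, Lemma II.4). [cite: BalabanOcarrollSchor1989, §II Lemma II.4] -/
def blockPropagator (U : GaugeConfig 4 (sch.M * L') G) (m r : ℝ) :
    Matrix (TorusSite 4 L' × Fin N × Fin 4) (TorusSite 4 L' × Fin N × Fin 4) ℂ :=
  QuantumLattice.blockPropagator (sch.a : ℂ) (sch.avg ρ U) (sch.avgBar ρ U) (wilsonDirac ρ U m r)

/-- The effective determinant factor `det (D_W(U) + aQ̄(U)Q(U))` of one block step, the
`U`-dependent weight fed to the gauge-field measure (BOS 1989, §II). [cite: BalabanOcarrollSchor1989, §II] -/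
def detFactor (U : GaugeConfig 4 (sch.M * L') G) (m r : ℝ) : ℂ :=
  QuantumLattice.blockDetFactor (sch.a : ℂ) (sch.avg ρ U) (sch.avgBar ρ U) (wilsonDirac ρ U m r)

/-- The block Wilson–Dirac operator of lattice QCD: gauge group `SU(3)` in the fundamental
representation, Wilson parameter `r = 1`, over the tree's `wilsonDirac (fundamentalRep (Fin 3)) U m 1`
(Montvay–Münster §5.1 (5.5) for the fine action). [cite: BalabanOcarrollSchor1989, §II Lemma II.2–II.3] -/
abbrev qcdBlockDirac (U : GaugeConfig 4 (sch.M * L') (Matrix.specialUnitaryGroup (Fin 3) ℂ)) (m : ℝ) :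
    Matrix (TorusSite 4 L' × Fin 3 × Fin 4) (TorusSite 4 L' × Fin 3 × Fin 4) ℂ :=
  sch.blockDirac (fundamentalRep (Fin 3)) U m 1

/-- A linear enumeration of the Wilson fermion variables (site, colour, spin) of the torus of side
`L` — the tree's Berezin integral needs linearly ordered generators (same device as
`QCDOS.FermiIdx`). [folklore] -/
abbrev WilsonIdx (L N : ℕ) [NeZero L] : Type := Fin (Fintype.card (TorusSite 4 L × Fin N × Fin 4))

/-- The fixed enumeration of the Wilson fermion variables. [folklore] -/
def wilsonIdxEquiv (L N : ℕ) [NeZero L] : TorusSite 4 L × Fin N × Fin 4 ≃ WilsonIdx L N :=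
  Fintype.equivFin _

/-- **The block RG transformation for Wilson fermions** in the background `U`: the map
`ρ(ψ̄, ψ) ↦ (T ρ)(χ̄, χ) = ∫ dψ̄dψ exp (-a Σ_y (χ̄ - ψ̄Q̄(U))_y (χ - Q(U)ψ)_y) ρ(ψ̄, ψ)` from Grassmann
densities of the fine torus (side `M L'`) to those of the coarse torus (side `L'`), an instance of
`fermionBlockRG` after enumerating the variables (BOS 1989, (1.1); Dimock 2022, §2). [cite: BalabanOcarrollSchor1989, §I (1.1)] -/
def transform (U : GaugeConfig 4 (sch.M * L') G) :
    GrassmannAlgebra ℂ (WilsonIdx (sch.M * L') N ⊕ₗ WilsonIdx (sch.M * L') N) →ₗ[ℂ]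
      GrassmannAlgebra ℂ (WilsonIdx L' N ⊕ₗ WilsonIdx L' N) :=
  fermionBlockRG ℂ (sch.a : ℂ)
    (reindex (wilsonIdxEquiv L' N) (wilsonIdxEquiv (sch.M * L') N) (sch.avg ρ U))
    (reindex (wilsonIdxEquiv (sch.M * L') N) (wilsonIdxEquiv L' N) (sch.avgBar ρ U))

/-- **Exact fermionic block RG step for Wilson fermions**: on the Boltzmann factor `exp (-ψ̄ D_W(U) ψ)`
the block transformation yields the effective determinant times the block Boltzmann factor,
`T(e^{-ψ̄D_Wψ}) = ε det(-(D_W + aQ̄Q)) · e^{-χ̄ D₁(U) χ}`, whenever the fluctuation operator is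
invertible (BOS 1989, Lemma II.2; Dimock 2022, §2). [cite: BalabanOcarrollSchor1989, §II Lemma II.2] -/
theorem transform_grassmannExp_wilsonDirac (U : GaugeConfig 4 (sch.M * L') G) (m r : ℝ)
    (hF : IsUnit (sch.fluctuationOp ρ U m r).det) :
    sch.transform ρ U (grassmannExp (quadratic ℂ
        (-reindex (wilsonIdxEquiv (sch.M * L') N) (wilsonIdxEquiv (sch.M * L') N) (wilsonDirac ρ U m r)))) =
      ((-1 : ℂ) ^ (Fintype.card (WilsonIdx (sch.M * L') N) * (Fintype.card (WilsonIdx (sch.M * L') N) - 1) / 2) *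
          (-(sch.fluctuationOp ρ U m r)).det) •
        grassmannExp (quadratic ℂ
          (-reindex (wilsonIdxEquiv L' N) (wilsonIdxEquiv L' N) (sch.blockDirac ρ U m r))) := by
  have hF' : IsUnit (QuantumLattice.fluctuationOp (sch.a : ℂ)
      (reindex (wilsonIdxEquiv L' N) (wilsonIdxEquiv (sch.M * L') N) (sch.avg ρ U))
      (reindex (wilsonIdxEquiv (sch.M * L') N) (wilsonIdxEquiv L' N) (sch.avgBar ρ U))
      (reindex (wilsonIdxEquiv (sch.M * L') N) (wilsonIdxEquiv (sch.M * L') N) (wilsonDirac ρ U m r))).det := by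
    rwa [fluctuationOp_reindex, det_reindex_self]
  rw [transform, fermionBlockRG_grassmannExp_quadratic ℂ _ _ _ _ hF', blockDirac_reindex,
    fluctuationOp_reindex]
  congr 2
  rw [reindex_apply, det_neg, det_neg, det_submatrix_equiv_self, Fintype.card_fin]
  rfl

/-- **Gauge covariance of the Wilson block averaging operator**:
`Q(U^g) = 𝒢'(g ∘ corner) Q(U) 𝒢(g)⁻¹` (Dimock 2022, §2). [cite: Dimock2022QED3, §2] -/
theorem avg_gaugeTransform (g : TorusSite 4 (sch.M * L') → G) (U : GaugeConfig 4 (sch.M * L') G) :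
    sch.avg ρ (gaugeTransform g U) =
      gaugeRotation ρ (Fin 4) (g ∘ torusBlockCorner sch.M L') * sch.avg ρ U * gaugeRotation ρ (Fin 4) g⁻¹ :=
  fermionBlockAvg_gaugeTransform ρ g U

/-- **Gauge covariance of the conjugate Wilson block averaging operator**:
`Q̄(U^g) = 𝒢(g) Q̄(U) 𝒢'(g ∘ corner)⁻¹` (Dimock 2022, §2). [cite: Dimock2022QED3, §2] -/
theorem avgBar_gaugeTransform (g : TorusSite 4 (sch.M * L') → G) (U : GaugeConfig 4 (sch.M * L') G) :
    sch.avgBar ρ (gaugeTransform g U) =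
      gaugeRotation ρ (Fin 4) g * sch.avgBar ρ U * gaugeRotation ρ (Fin 4) (g ∘ torusBlockCorner sch.M L')⁻¹ :=
  fermionBlockAvgBar_gaugeTransform ρ g U

/-- **Gauge covariance of the Wilson fluctuation operator**: `F(U^g) = 𝒢(g) F(U) 𝒢(g)⁻¹`
(Dimock 2022, §2). [cite: Dimock2022QED3, §2] -/
theorem fluctuationOp_gaugeTransform (g : TorusSite 4 (sch.M * L') → G) (U : GaugeConfig 4 (sch.M * L') G)
    (m r : ℝ) :
    sch.fluctuationOp ρ (gaugeTransform g U) m r =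
      gaugeRotation ρ (Fin 4) g * sch.fluctuationOp ρ U m r * gaugeRotation ρ (Fin 4) g⁻¹ := by
  rw [fluctuationOp, fluctuationOp, avg_gaugeTransform, avgBar_gaugeTransform,
    wilsonDirac_gaugeTransform]
  exact fluctuationOp_conj _ _ _ (gaugeRotation_inv_mul ρ (g ∘ torusBlockCorner sch.M L')) _ _ _

/-- **Gauge covariance of the block Wilson–Dirac operator**: the block action transforms with the
COARSE gauge transformation `g' = g ∘ (block corner)` only, `D₁(U^g) = 𝒢'(g') D₁(U) 𝒢'(g')⁻¹` — one
covariant block RG step commutes with gauge transformations (Dimock 2022, §2). [cite: Dimock2022QED3, §2] -/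
theorem blockDirac_gaugeTransform (g : TorusSite 4 (sch.M * L') → G) (U : GaugeConfig 4 (sch.M * L') G)
    (m r : ℝ) :
    sch.blockDirac ρ (gaugeTransform g U) m r =
      gaugeRotation ρ (Fin 4) (g ∘ torusBlockCorner sch.M L') * sch.blockDirac ρ U m r *
        gaugeRotation ρ (Fin 4) (g ∘ torusBlockCorner sch.M L')⁻¹ := by
  rw [blockDirac, blockDirac, avg_gaugeTransform, avgBar_gaugeTransform, wilsonDirac_gaugeTransform]
  exact blockDirac_conj _ (gaugeRotation_inv_mul ρ g)
    (gaugeRotation_inv_mul ρ (g ∘ torusBlockCorner sch.M L')) _ _ _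

/-- **Gauge invariance of the effective fermion determinant** of one block step:
`det F(U^g) = det F(U)` (the `U`-dependent factor handed to the gauge-field measure is a gauge-invariant
function of the fine field; Dimock 2022, §2). [cite: Dimock2022QED3, §2] -/
theorem detFactor_gaugeTransform (g : TorusSite 4 (sch.M * L') → G) (U : GaugeConfig 4 (sch.M * L') G)
    (m r : ℝ) :
    sch.detFactor ρ (gaugeTransform g U) m r = sch.detFactor ρ U m r := by
  have hdet : (gaugeRotation ρ (Fin 4) g⁻¹).det * (gaugeRotation ρ (Fin 4) g).det = 1 := by
    rw [← det_mul, gaugeRotation_inv_mul, det_one]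
  unfold detFactor blockDetFactor
  change (sch.fluctuationOp ρ (gaugeTransform g U) m r).det = (sch.fluctuationOp ρ U m r).det
  rw [fluctuationOp_gaugeTransform, det_mul, det_mul]
  calc (gaugeRotation ρ (Fin 4) g).det * (sch.fluctuationOp ρ U m r).det * (gaugeRotation ρ (Fin 4) g⁻¹).det
      = (sch.fluctuationOp ρ U m r).det *
          ((gaugeRotation ρ (Fin 4) g⁻¹).det * (gaugeRotation ρ (Fin 4) g).det) := by ring
    _ = (sch.fluctuationOp ρ U m r).det := by rw [hdet, mul_one]

end WilsonFermionBlockAveraging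

end Wilson

end QLatticeAQFT

end Literature.MathematicalPhysics.QuantumLattice
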